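import Mathlib
import HarnessLib
import Literature.NumberTheory.Automorphic.HilbertSiegelModularFormModN

/-!
# The paramodular group `K(N) ≤ Sp₄(ℚ)` of level `N` (degree two)

Requested by the paramodularity certificate programme (cell `pub-paramod`, papers/Langlands/
paramodular-factory): the level structure of the weight-2 Siegel paramodular newforms `f_N` of
Brumer–Pacetti–Poor–Tornaría–Voight–Yuen [BrumerEtAl2019, §4.2]. This file defines ONLY the group;
paramodular FORMS, the Hecke operators `T(p)`, `T₁(p²)` and the spinor Euler factor `Q_p(f,T)` of
[BrumerEtAl2019, (4.2.7)–(4.2.18)] are the next file.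

## The definition as printed

[BrumerEtAl2019, (4.2.3)] (following Freitag and Poor–Yuen): for `N ∈ ℤ_{≥ 1}`,
```
K(N) := ( ℤ   Nℤ  ℤ   ℤ    )
        ( ℤ   ℤ   ℤ   N⁻¹ℤ )   ∩  Sp₄(ℚ).
        ( ℤ   Nℤ  ℤ   ℤ    )
        ( Nℤ  Nℤ  Nℤ  ℤ    )
```
Here `Sp₄(ℚ)` is taken in `2 × 2` block form `M = (A B; C D)`, `Mᵀ J' M = J'` with
`J' = (0 1; -1 0)` [BrumerEtAl2019, §4.2]. We realise it as Mathlib's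
`Matrix.symplecticGroup (Fin 2) ℚ = {M | M J Mᵀ = J}`, `J = Matrix.J (Fin 2) ℚ = (0 -1; 1 0) = -J'`
(the tree's `HilbertSiegel.Sp4 ℚ`): the two conditions define the same group, since `J' = -J`
and `M J Mᵀ = J ↔ Mᵀ J M = J` for the group of symplectic matrices (Mathlib:
`Matrix.SymplecticGroup.transpose_mem_iff`). Rows/columns `1, 2, 3, 4` of the display are the
indices `inl 0, inl 1, inr 0, inr 1` of `Fin 2 ⊕ Fin 2`.

We encode the display by the exponent table `paramodularExp i j ∈ {-1, 0, 1}` (`N^e ℤ` in entry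
`(i,j)`), so that `M ∈ K(N) ↔ M ∈ Sp₄(ℚ) ∧ ∀ i j, M i j ∈ N^{e i j} ℤ`. That this set is a
SUBGROUP is proved here (not assumed): closure under products is the "order" inequality
`e i j ≤ e i k + e k j` (checked by `decide`), closure under inverses is the symplectic inverse
formula `M⁻¹ = -J Mᵀ J = (Dᵀ -Bᵀ; -Cᵀ Aᵀ)` together with the symmetry `e (τ j) (τ i) = e i j`
of the table under the block swap `τ`.

## Contents
* `paramodularExp`, `paramodularExp_le_add`, `paramodularExp_swap` — the table and its two
  combinatorial properties;
* `Sp4.coe_inv_apply` — entries of the inverse of a symplectic `4 × 4` matrix;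
* `paramodularGroup N : Subgroup (HilbertSiegel.Sp4 ℚ)` for `N ≠ 0` (`[NeZero N]`), with
  `mem_paramodularGroup_iff` and the level-one sanity statement `mem_paramodularGroup_one_iff`
  (`K(1)` = the integral points `Sp₄(ℤ)` inside `Sp₄(ℚ)`).

## Not here
The Fricke involution `μ_N` [BrumerEtAl2019, (4.2.4)] (it lies in `Sp₄(ℝ)`, not `Sp₄(ℚ)`);
paramodular groups of higher degree; the local groups `K(l^n) ≤ GSp₄(ℚ_l)` of Roberts–Schmidt
(BCGP use those; same display, [BoxerCalegariGeePilloni2025, §7.5]).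
-/

open scoped Matrix

namespace Literature.NumberTheory.Automorphic.Paramodular

open HilbertSiegel

/-- Index swap `τ : inl a ↔ inr a` on `Fin 2 ⊕ Fin 2` (rows `1 ↔ 3`, `2 ↔ 4` of the `4 × 4`
display): the permutation underlying the symplectic inverse `M⁻¹ = -J Mᵀ J`. [folklore] -/
abbrev blockSwap : Fin 2 ⊕ Fin 2 → Fin 2 ⊕ Fin 2 := Sum.swap

/-- The sign `s(i,j) ∈ {1, -1}` in the symplectic inverse formula
`(M⁻¹) i j = s(i,j) · M (τ j) (τ i)`: `+1` on the diagonal blocks, `-1` on the off-diagonal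
blocks (`M⁻¹ = (Dᵀ -Bᵀ; -Cᵀ Aᵀ)`). [folklore] -/
def invSign : Fin 2 ⊕ Fin 2 → Fin 2 ⊕ Fin 2 → ℤ
  | Sum.inl _, Sum.inl _ => 1
  | Sum.inl _, Sum.inr _ => -1
  | Sum.inr _, Sum.inl _ => -1
  | Sum.inr _, Sum.inr _ => 1

/-- The exponent table of the paramodular group of level `N` [BrumerEtAl2019, (4.2.3)]:
entry `(i,j)` of a matrix in `K(N)` lies in `N ^ (paramodularExp i j) · ℤ`. Rows `inl 0, inl 1,
inr 0, inr 1` = rows `1, 2, 3, 4` of the printed display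
`(ℤ Nℤ ℤ ℤ; ℤ ℤ ℤ N⁻¹ℤ; ℤ Nℤ ℤ ℤ; Nℤ Nℤ Nℤ ℤ)`. [cite: BrumerEtAl2019, (4.2.3)] -/
def paramodularExp : Fin 2 ⊕ Fin 2 → Fin 2 ⊕ Fin 2 → ℤ
  | Sum.inl 0, Sum.inl 1 => 1
  | Sum.inl 1, Sum.inr 1 => -1
  | Sum.inr 0, Sum.inl 1 => 1
  | Sum.inr 1, Sum.inl 0 => 1
  | Sum.inr 1, Sum.inl 1 => 1
  | Sum.inr 1, Sum.inr 0 => 1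
  | _, _ => 0

/-- The diagonal exponents vanish (the identity matrix lies in `K(N)`). [folklore] -/
theorem paramodularExp_self (i : Fin 2 ⊕ Fin 2) : paramodularExp i i = 0 := by
  revert i; decide

/-- The "order" inequality of the paramodular display: `e(i,j) ≤ e(i,k) + e(k,j)` for all
`i, k, j` — equivalently the additive group `Λ(N) = {M ∈ M₄(ℚ) : M i j ∈ N^{e(i,j)} ℤ}` is closed
under matrix multiplication (it is a ℤ-order in `M₄(ℚ)`), which is what makes `K(N)` closed under
products. [folklore] -/
theorem paramodularExp_le_add (i k j : Fin 2 ⊕ Fin 2) :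
    paramodularExp i j ≤ paramodularExp i k + paramodularExp k j := by
  revert i k j; decide

/-- Symmetry of the display under the symplectic inverse: `e(τ j, τ i) = e(i,j)`, i.e. the
pattern of `(Dᵀ -Bᵀ; -Cᵀ Aᵀ)` is the pattern of `(A B; C D)`. [folklore] -/
theorem paramodularExp_swap (i j : Fin 2 ⊕ Fin 2) :
    paramodularExp (blockSwap j) (blockSwap i) = paramodularExp i j := by
  revert i j; decide

/-- Entries of the inverse of a symplectic matrix `γ ∈ Sp₄(R)` (`R` a commutative ring):
`(γ⁻¹) i j = s(i,j) · γ (τ j) (τ i)`, the entrywise form of `γ⁻¹ = -J γᵀ J = (Dᵀ -Bᵀ; -Cᵀ Aᵀ)`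
for `γ = (A B; C D)`. [folklore] -/
theorem Sp4.coe_inv_apply {R : Type*} [CommRing R] (γ : Sp4 R) (i j : Fin 2 ⊕ Fin 2) :
    ((γ⁻¹ : Sp4 R) : Matrix (Fin 2 ⊕ Fin 2) (Fin 2 ⊕ Fin 2) R) i j =
      (invSign i j : R) * (γ : Matrix (Fin 2 ⊕ Fin 2) (Fin 2 ⊕ Fin 2) R) (blockSwap j) (blockSwap i) := by
  rw [SymplecticGroup.coe_inv]
  rcases i with a | a <;> rcases j with b | b <;>
    simp [Matrix.mul_apply, Matrix.J, Matrix.fromBlocks, Fintype.sum_sum_type, Matrix.one_apply,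
      invSign, blockSwap]

/-- **The paramodular group `K(N)` of level `N ≥ 1` in degree two** [BrumerEtAl2019, (4.2.3)]:
the symplectic matrices `γ ∈ Sp₄(ℚ)` (the tree's `HilbertSiegel.Sp4 ℚ`, Mathlib's
`Matrix.symplecticGroup (Fin 2) ℚ`) whose `(i,j)` entry lies in `N ^ (paramodularExp i j) · ℤ`,
i.e. `γ ∈ (ℤ Nℤ ℤ ℤ; ℤ ℤ ℤ N⁻¹ℤ; ℤ Nℤ ℤ ℤ; Nℤ Nℤ Nℤ ℤ) ∩ Sp₄(ℚ)`. It is a subgroup (proved: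
`one_mem'`, `mul_mem'` by `paramodularExp_le_add`, `inv_mem'` by `Sp4.coe_inv_apply` and
`paramodularExp_swap`). For `N = 1` it is `Sp₄(ℤ)` (`mem_paramodularGroup_one_iff`).
[cite: BrumerEtAl2019, (4.2.3)] -/
def paramodularGroup (N : ℕ) [NeZero N] : Subgroup (Sp4 ℚ) where
  carrier := {γ | ∀ i j, ∃ z : ℤ,
    (γ : Matrix (Fin 2 ⊕ Fin 2) (Fin 2 ⊕ Fin 2) ℚ) i j = (N : ℚ) ^ (paramodularExp i j) * z}
  one_mem' := by
    intro i j
    by_cases h : i = j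
    · subst h
      exact ⟨1, by simp [paramodularExp_self]⟩
    · exact ⟨0, by simp [h]⟩
  mul_mem' := by
    intro γ δ hγ hδ i j
    have hN : (N : ℚ) ≠ 0 := by exact_mod_cast (NeZero.ne N)
    choose z hz using fun k => hγ i k
    choose w hw using fun k => hδ k j
    refine ⟨∑ k, (N : ℤ) ^ (paramodularExp i k + paramodularExp k j - paramodularExp i j).toNat
      * z k * w k, ?_⟩
    rw [show ((γ * δ : Sp4 ℚ) : Matrix (Fin 2 ⊕ Fin 2) (Fin 2 ⊕ Fin 2) ℚ) =
        (γ : Matrix (Fin 2 ⊕ Fin 2) (Fin 2 ⊕ Fin 2) ℚ) * (δ : Matrix (Fin 2 ⊕ Fin 2) (Fin 2 ⊕ Fin 2) ℚ)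
        from rfl, Matrix.mul_apply, Int.cast_sum, Finset.mul_sum]
    refine Finset.sum_congr rfl fun k _ => ?_
    have hd : 0 ≤ paramodularExp i k + paramodularExp k j - paramodularExp i j := by
      have := paramodularExp_le_add i k j; omega
    rw [hz k, hw k]
    have key : (N : ℚ) ^ paramodularExp i k * (N : ℚ) ^ paramodularExp k j =
        (N : ℚ) ^ paramodularExp i j *
          (N : ℚ) ^ ((paramodularExp i k + paramodularExp k j - paramodularExp i j).toNat : ℤ) := by
      rw [Int.toNat_of_nonneg hd, ← zpow_add₀ hN, ← zpow_add₀ hN]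
      congr 1; omega
    push_cast
    rw [zpow_natCast] at key
    calc (N : ℚ) ^ paramodularExp i k * (z k : ℚ) * ((N : ℚ) ^ paramodularExp k j * (w k : ℚ))
        = ((N : ℚ) ^ paramodularExp i k * (N : ℚ) ^ paramodularExp k j) * (z k * w k) := by ring
      _ = (N : ℚ) ^ paramodularExp i j *
          ((N : ℚ) ^ (paramodularExp i k + paramodularExp k j - paramodularExp i j).toNat
            * (z k : ℚ) * (w k : ℚ)) := by rw [key]; ring
  inv_mem' := by
    intro γ hγ i j
    obtain ⟨z, hz⟩ := hγ (blockSwap j) (blockSwap i)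
    refine ⟨invSign i j * z, ?_⟩
    rw [Sp4.coe_inv_apply, hz, paramodularExp_swap]
    push_cast
    ring

/-- Membership in `K(N)`: every entry `γ i j` lies in `N ^ (paramodularExp i j) · ℤ`.
[cite: BrumerEtAl2019, (4.2.3)] -/
theorem mem_paramodularGroup_iff {N : ℕ} [NeZero N] {γ : Sp4 ℚ} :
    γ ∈ paramodularGroup N ↔ ∀ i j, ∃ z : ℤ,
      (γ : Matrix (Fin 2 ⊕ Fin 2) (Fin 2 ⊕ Fin 2) ℚ) i j = (N : ℚ) ^ (paramodularExp i j) * z :=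
  Iff.rfl

/-- Level one: `K(1)` is the set of symplectic matrices with INTEGER entries, i.e. `Sp₄(ℤ)` inside
`Sp₄(ℚ)` ("a subgroup commensurable with `Sp₄(ℤ)`", [BrumerEtAl2019, §4.2]). [folklore] -/
theorem mem_paramodularGroup_one_iff {γ : Sp4 ℚ} :
    γ ∈ paramodularGroup 1 ↔
      ∀ i j, ∃ z : ℤ, (γ : Matrix (Fin 2 ⊕ Fin 2) (Fin 2 ⊕ Fin 2) ℚ) i j = z := by
  simp [mem_paramodularGroup_iff]

/-- The block-entry reading of membership, matching the printed display row by row: for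
`γ = (A B; C D) ∈ Sp₄(ℚ)`, `γ ∈ K(N)` iff `A ∈ (ℤ Nℤ; ℤ ℤ)`, `B ∈ (ℤ ℤ; ℤ N⁻¹ℤ)`,
`C ∈ (ℤ Nℤ; Nℤ Nℤ)`, `D ∈ (ℤ ℤ; Nℤ ℤ)` — stated through the exponent table on each block.
[cite: BrumerEtAl2019, (4.2.3)] -/
theorem mem_paramodularGroup_iff_blocks {N : ℕ} [NeZero N] {γ : Sp4 ℚ} :
    γ ∈ paramodularGroup N ↔
      (∀ a b, ∃ z : ℤ, blockA γ a b = (N : ℚ) ^ paramodularExp (Sum.inl a) (Sum.inl b) * z) ∧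
      (∀ a b, ∃ z : ℤ, blockB γ a b = (N : ℚ) ^ paramodularExp (Sum.inl a) (Sum.inr b) * z) ∧
      (∀ a b, ∃ z : ℤ, blockC γ a b = (N : ℚ) ^ paramodularExp (Sum.inr a) (Sum.inl b) * z) ∧
      (∀ a b, ∃ z : ℤ, blockD γ a b = (N : ℚ) ^ paramodularExp (Sum.inr a) (Sum.inr b) * z) := by
  rw [mem_paramodularGroup_iff]
  constructor
  · intro h
    exact ⟨fun a b => h _ _, fun a b => h _ _, fun a b => h _ _, fun a b => h _ _⟩
  · rintro ⟨hA, hB, hC, hD⟩ (a | a) (b | b)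
    · exact hA a b
    · exact hB a b
    · exact hC a b
    · exact hD a b

end Literature.NumberTheory.Automorphic.Paramodular
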